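import Literature.Computability.ImplicitComplexity.STARenaming
import Literature.Computability.ImplicitComplexity.STATypeSubst
import Mathlib.Algebra.BigOperators.Group.Finset.Basic
import Mathlib.Algebra.Order.BigOperators.Group.Finset
import HarnessLib

/-!
# Typed substitution data for the `STA` substitution lemma

Support file for the `PTIME` soundness half of `STACapturesP` (GMR08 Thm. 3.5). The weighted
substitution lemma of [GR07, Lemma 4.3] / [GMR08, Lemma 3.4] ("`Π ▹ Γ, x : μ ⊢ M : σ` and
`Σ ▹ Δ ⊢ N : μ`, `Γ # Δ` give `S(Σ, Π) ▹ Γ, Δ ⊢ M[N/x] : σ` with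
`W(S(Σ,Π), r) ≤ W(Π, r) + W(Σ, r)`") is proved by induction on `Π`; below a multiplexor the ONE
substituted variable becomes `n ≤ r` variables receiving renamed-apart copies of the box of `N`,
so the induction hypothesis must speak about SIMULTANEOUS substitutions. This file sets up that
bookkeeping in de Bruijn form:

* `Ctx.iUnion Δ` — the union of a slot-indexed family of pairwise disjoint contexts;
* `SubstData r D Θ θ Δ cost` — a typed parallel substitution `θ` out of the context `Θ`: every
  slot `i` of `Θ` (type `τ`) is either RENAMED (`θ i = xᵢ'`, `Δ i = (xᵢ' : τ)`, cost `0`) or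
  SUBSTITUTED by a term with its own derivation `Δ i ⊢ θ i : τ` of degree `≤ D` and weight
  `cost i`; the pieces `Δ i` are pairwise disjoint and uniformly finitely supported;
* the transformations of such data used by the structural cases of the substitution lemma:
  restriction to a sub-context (`SubstData.restrict`, for `(⊸E)`, `(w)`), passage under a term
  binder (`SubstData.up`, for `(⊸I)`), and under a type binder (`SubstData.shiftT`, for `(∀I)`),
  with the corresponding descriptions of `Ctx.iUnion` and of the total cost
  `∑_{i<n} cost i`.

## References

* [GaboardiMarionRonchidellarocca2008] GMR08, §3.1 (Lemma 3.4: "The weight of a proof decreases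
  when a β-reduction is performed"), Table 2.
* [GaboardiRonchiDellaRocca2007] GR07, §4 (Substitution Lemma).
-/

namespace Literature.Computability.ImplicitComplexity

namespace STA

/-! ### Unions of disjoint context families -/

namespace Ctx

/-- A slot-indexed family of contexts is pairwise disjoint. [folklore] -/
def PairwiseDisjoint (Δ : ℕ → Ctx) : Prop :=
  ∀ i₁ i₂ i', i₁ ≠ i₂ → Δ i₁ i' ≠ none → Δ i₂ i' = none

/-- The union `⋃ᵢ Δ i` of a family of pairwise disjoint contexts. [folklore] -/
noncomputable def iUnion (Δ : ℕ → Ctx) : Ctx := fun i' =>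
  by classical exact if h : ∃ i, Δ i i' ≠ none then Δ (Classical.choose h) i' else none

/-- Slots empty in every piece are empty in the union. [folklore] -/
theorem iUnion_eq_none {Δ : ℕ → Ctx} {i' : ℕ} (h : ∀ i, Δ i i' = none) : iUnion Δ i' = none := by
  classical
  unfold iUnion
  rw [dif_neg]
  rintro ⟨i, hi⟩
  exact hi (h i)

/-- The union agrees with each piece on its support. [folklore] -/
theorem iUnion_apply {Δ : ℕ → Ctx} (hd : PairwiseDisjoint Δ) {i i' : ℕ} (h : Δ i i' ≠ none) :
    iUnion Δ i' = Δ i i' := by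
  classical
  unfold iUnion
  have hex : ∃ i₀, Δ i₀ i' ≠ none := ⟨i, h⟩
  rw [dif_pos hex]
  have h1 := Classical.choose_spec hex
  by_contra hne
  have hii : Classical.choose hex ≠ i := fun e => hne (by rw [e])
  exact h1 (hd i _ i' (Ne.symm hii) h)

/-- Nonempty slots of the union come from some piece. [folklore] -/
theorem exists_of_iUnion_ne_none {Δ : ℕ → Ctx} {i' : ℕ} (h : iUnion Δ i' ≠ none) :
    ∃ i, Δ i i' ≠ none := by
  by_contra hne
  exact h (iUnion_eq_none fun i => by by_contra h0; exact hne ⟨i, h0⟩)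

/-- The union is nonempty at a slot iff some piece is. [folklore] -/
theorem iUnion_ne_none_iff {Δ : ℕ → Ctx} (hd : PairwiseDisjoint Δ) {i' : ℕ} :
    iUnion Δ i' ≠ none ↔ ∃ i, Δ i i' ≠ none :=
  ⟨exists_of_iUnion_ne_none, fun ⟨i, hi⟩ => by rw [iUnion_apply hd hi]; exact hi⟩

/-- **Extensionality for unions.** [folklore] -/
theorem iUnion_eq_of {Δ : ℕ → Ctx} (hd : PairwiseDisjoint Δ) {Φ : Ctx}
    (h₁ : ∀ i i', Δ i i' ≠ none → Φ i' = Δ i i')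
    (h₂ : ∀ i', Φ i' ≠ none → ∃ i, Δ i i' ≠ none) : iUnion Δ = Φ := by
  funext i'
  by_cases h : ∃ i, Δ i i' ≠ none
  · obtain ⟨i, hi⟩ := h
    rw [iUnion_apply hd hi, h₁ i i' hi]
  · rw [iUnion_eq_none fun i => by by_contra h0; exact h ⟨i, h0⟩]
    by_contra hne
    exact h (h₂ i' (Ne.symm hne))

/-- Mapping assumptions commutes with unions. [folklore] -/
theorem iUnion_map {Δ : ℕ → Ctx} (hd : PairwiseDisjoint Δ) (f : SoftTy → SoftTy) :
    iUnion (fun i i' => (Δ i i').map f) = fun i' => (iUnion Δ i').map f := by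
  have hd' : PairwiseDisjoint fun i i' => (Δ i i').map f := by
    intro i₁ i₂ i' hne h
    have h0 : Δ i₁ i' ≠ none := fun e => h (by simp [e])
    simp [hd i₁ i₂ i' hne h0]
  refine iUnion_eq_of hd' (fun i i' hi => ?_) (fun i' hi' => ?_)
  · have h0 : Δ i i' ≠ none := fun e => hi (by simp [e])
    simp [iUnion_apply hd h0]
  · have h0 : iUnion Δ i' ≠ none := fun e => hi' (by simp [e])
    obtain ⟨i, hi⟩ := exists_of_iUnion_ne_none h0
    exact ⟨i, by simp [Option.map_eq_none_iff, hi]⟩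

/-- A uniformly bounded family has a bounded union. [folklore] -/
theorem iUnion_boundedBy {Δ : ℕ → Ctx} {m : ℕ} (hb : ∀ i i', m ≤ i' → Δ i i' = none) :
    (iUnion Δ).BoundedBy m :=
  fun i' hi' => iUnion_eq_none fun i => hb i i' hi'

end Ctx

/-! ### Typed substitution data -/

/-- **Typed partial substitution out of `Θ`.** For every slot `i` of `Θ` of type `τ`, either
`θ i` is a variable `xᵢ'` and `Δ i` is the singleton context `xᵢ' : τ` (a RENAMED slot, cost
`0`), or `Δ i ⊢ θ i : τ` is derivable with degree `≤ D`, ranks `≤ r` and weight `cost i`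
(a SUBSTITUTED slot); slots off the support of `Θ` carry empty pieces and cost `0`; the pieces
are pairwise disjoint and uniformly finitely supported. This is the data of `|supp Θ|`
simultaneous instances of GR07's substitution lemma. [cite: GaboardiMarionRonchidellarocca2008, §3.1 (Lemma 3.4)] -/
structure SubstData (r D : ℕ) (Θ : Ctx) (θ : ℕ → Term) (Δ : ℕ → Ctx) (cost : ℕ → ℕ) : Prop where
  /-- every slot of `Θ` is renamed or substituted -/
  slot : ∀ i τ, Θ i = some τ →
    (∃ i', θ i = .var i' ∧ (Δ i).IsSingleton i' τ ∧ cost i = 0) ∨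
    (∃ dᵢ, dᵢ ≤ D ∧ MTyping r (cost i) dᵢ (Δ i) (θ i) τ)
  /-- slots off the support contribute nothing -/
  off : ∀ i, Θ i = none → (∀ i', Δ i i' = none) ∧ cost i = 0
  /-- the pieces are pairwise disjoint -/
  disj : Ctx.PairwiseDisjoint Δ
  /-- the pieces are uniformly finitely supported -/
  bdd : ∃ m, ∀ i i', m ≤ i' → Δ i i' = none

namespace SubstData

variable {r D : ℕ} {Θ : Ctx} {θ : ℕ → Term} {Δ : ℕ → Ctx} {cost : ℕ → ℕ}

/-- Free variables of the substituted terms lie in their pieces. [folklore] -/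
theorem freeIn_piece (hS : SubstData r D Θ θ Δ cost) {i : ℕ} (hi : Θ i ≠ none) {i' : ℕ}
    (hf : (θ i).FreeIn i') : Δ i i' ≠ none := by
  obtain ⟨τ, hτ⟩ := Option.ne_none_iff_exists'.1 hi
  rcases hS.slot i τ hτ with ⟨j, hθ, hsing, -⟩ | ⟨dᵢ, -, hder⟩
  · rw [hθ] at hf
    simp only [Term.FreeIn] at hf
    subst hf
    rw [hsing.1]
    simp
  · exact hder.isSome_of_freeIn hf

/-- Costs vanish off the support. [folklore] -/
theorem cost_eq_zero (hS : SubstData r D Θ θ Δ cost) {i : ℕ} (hi : Θ i = none) : cost i = 0 :=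
  (hS.off i hi).2

/-- The degree bound may be raised. [folklore] -/
theorem mono_degree (hS : SubstData r D Θ θ Δ cost) {D' : ℕ} (hD : D ≤ D') :
    SubstData r D' Θ θ Δ cost where
  slot i τ hτ := by
    rcases hS.slot i τ hτ with h | ⟨dᵢ, hd, hder⟩
    · exact Or.inl h
    · exact Or.inr ⟨dᵢ, hd.trans hD, hder⟩
  off := hS.off
  disj := hS.disj
  bdd := hS.bdd

/-! #### Restriction to a sub-context (cases `(⊸E)`, `(w)`) -/

/-- Restrict the pieces to the support of `Θ₁`. [folklore] -/
def restrictΔ (Θ₁ : Ctx) (Δ : ℕ → Ctx) : ℕ → Ctx := fun i =>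
  match Θ₁ i with
  | none => Ctx.empty
  | some _ => Δ i

/-- Restrict the costs to the support of `Θ₁`. [folklore] -/
def restrictCost (Θ₁ : Ctx) (cost : ℕ → ℕ) : ℕ → ℕ := fun i =>
  match Θ₁ i with
  | none => 0
  | some _ => cost i

/-- Restricted piece off the support. [folklore] -/
theorem restrictΔ_of_none {Θ₁ : Ctx} {Δ : ℕ → Ctx} {i : ℕ} (h : Θ₁ i = none) :
    restrictΔ Θ₁ Δ i = Ctx.empty := by
  simp [restrictΔ, h]

/-- Restricted piece on the support. [folklore] -/
theorem restrictΔ_of_some {Θ₁ : Ctx} {Δ : ℕ → Ctx} {i : ℕ} {τ : SoftTy} (h : Θ₁ i = some τ) :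
    restrictΔ Θ₁ Δ i = Δ i := by
  simp [restrictΔ, h]

/-- Restricted cost off the support. [folklore] -/
theorem restrictCost_of_none {Θ₁ : Ctx} {cost : ℕ → ℕ} {i : ℕ} (h : Θ₁ i = none) :
    restrictCost Θ₁ cost i = 0 := by
  simp [restrictCost, h]

/-- Restricted cost on the support. [folklore] -/
theorem restrictCost_of_some {Θ₁ : Ctx} {cost : ℕ → ℕ} {i : ℕ} {τ : SoftTy} (h : Θ₁ i = some τ) :
    restrictCost Θ₁ cost i = cost i := by
  simp [restrictCost, h]

/-- A restricted piece is contained in the original piece. [folklore] -/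
theorem restrictΔ_ne_none {Θ₁ : Ctx} {Δ : ℕ → Ctx} {i i' : ℕ} (h : restrictΔ Θ₁ Δ i i' ≠ none) :
    Θ₁ i ≠ none ∧ Δ i i' ≠ none ∧ restrictΔ Θ₁ Δ i i' = Δ i i' := by
  cases hΘ : Θ₁ i with
  | none => rw [restrictΔ_of_none hΘ] at h; exact absurd rfl h
  | some τ =>
    rw [restrictΔ_of_some hΘ] at h ⊢
    exact ⟨by simp, h, rfl⟩

/-- **Restriction of substitution data to a sub-context.** [folklore] -/
theorem restrict (hS : SubstData r D Θ θ Δ cost) {Θ₁ : Ctx}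
    (hle : ∀ i, Θ₁ i ≠ none → Θ₁ i = Θ i) :
    SubstData r D Θ₁ θ (restrictΔ Θ₁ Δ) (restrictCost Θ₁ cost) where
  slot i τ hτ := by
    rw [restrictΔ_of_some hτ, restrictCost_of_some hτ]
    exact hS.slot i τ (by rw [← hle i (by rw [hτ]; simp), hτ])
  off i hi := ⟨fun i' => by rw [restrictΔ_of_none hi]; rfl, restrictCost_of_none hi⟩
  disj i₁ i₂ i' hne h := by
    obtain ⟨-, h₁, -⟩ := restrictΔ_ne_none h
    cases hΘ : Θ₁ i₂ with
    | none => rw [restrictΔ_of_none hΘ]; rfl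
    | some τ => rw [restrictΔ_of_some hΘ]; exact hS.disj i₁ i₂ i' hne h₁
  bdd := by
    obtain ⟨m, hm⟩ := hS.bdd
    refine ⟨m, fun i i' hi' => ?_⟩
    cases hΘ : Θ₁ i with
    | none => rw [restrictΔ_of_none hΘ]; rfl
    | some τ => rw [restrictΔ_of_some hΘ]; exact hm i i' hi'

/-- The union of the restricted pieces is a sub-context of the union. [folklore] -/
theorem iUnion_restrict_le (hS : SubstData r D Θ θ Δ cost) (Θ₁ : Ctx) (i' : ℕ)
    (h : Ctx.iUnion (restrictΔ Θ₁ Δ) i' ≠ none) :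
    Ctx.iUnion Δ i' = Ctx.iUnion (restrictΔ Θ₁ Δ) i' := by
  obtain ⟨i, hi⟩ := Ctx.exists_of_iUnion_ne_none h
  obtain ⟨-, hΔ, heq⟩ := restrictΔ_ne_none hi
  have hdisj : Ctx.PairwiseDisjoint (restrictΔ Θ₁ Δ) := by
    intro i₁ i₂ j hne h₁
    obtain ⟨-, h₁', -⟩ := restrictΔ_ne_none h₁
    cases hΘ : Θ₁ i₂ with
    | none => rw [restrictΔ_of_none hΘ]; rfl
    | some τ => rw [restrictΔ_of_some hΘ]; exact hS.disj i₁ i₂ j hne h₁'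
  rw [Ctx.iUnion_apply hS.disj hΔ, Ctx.iUnion_apply hdisj hi, heq]

/-- Disjointness of the restricted pieces. [folklore] -/
theorem restrict_disj (hS : SubstData r D Θ θ Δ cost) (Θ₁ : Ctx) :
    Ctx.PairwiseDisjoint (restrictΔ Θ₁ Δ) := by
  intro i₁ i₂ j hne h₁
  obtain ⟨-, h₁', -⟩ := restrictΔ_ne_none h₁
  cases hΘ : Θ₁ i₂ with
  | none => rw [restrictΔ_of_none hΘ]; rfl
  | some τ => rw [restrictΔ_of_some hΘ]; exact hS.disj i₁ i₂ j hne h₁'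

/-- **Splitting the union along a context splitting.** If `Θ = Θ₁, Θ₂` then the union of the
pieces splits into the unions of the restricted pieces. [folklore] -/
theorem split_iUnion (hS : SubstData r D Θ θ Δ cost) {Θ₁ Θ₂ : Ctx} (hsp : Θ.Split Θ₁ Θ₂) :
    (Ctx.iUnion Δ).Split (Ctx.iUnion (restrictΔ Θ₁ Δ)) (Ctx.iUnion (restrictΔ Θ₂ Δ)) := by
  intro i'
  by_cases h : ∃ i, Δ i i' ≠ none
  · obtain ⟨i, hi⟩ := h
    have hΘi : Θ i ≠ none := fun h0 => hi ((hS.off i h0).1 i')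
    rw [Ctx.iUnion_apply hS.disj hi]
    -- which side owns slot `i`
    have hnone₂ : ∀ {Θ' : Ctx}, Θ' i = none → Ctx.iUnion (restrictΔ Θ' Δ) i' = none := by
      intro Θ' hΘ'
      refine Ctx.iUnion_eq_none fun i₂ => ?_
      by_cases hi₂ : i₂ = i
      · subst hi₂; rw [restrictΔ_of_none hΘ']; rfl
      · cases hΘ₂ : Θ' i₂ with
        | none => rw [restrictΔ_of_none hΘ₂]; rfl
        | some τ => rw [restrictΔ_of_some hΘ₂]; exact hS.disj i i₂ i' (Ne.symm hi₂) hi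
    have hsome₁ : ∀ {Θ' : Ctx}, Θ' i ≠ none → Ctx.iUnion (restrictΔ Θ' Δ) i' = Δ i i' := by
      intro Θ' hΘ'
      obtain ⟨τ, hτ⟩ := Option.ne_none_iff_exists'.1 hΘ'
      have : restrictΔ Θ' Δ i i' ≠ none := by rw [restrictΔ_of_some hτ]; exact hi
      rw [Ctx.iUnion_apply (hS.restrict_disj Θ') this, restrictΔ_of_some hτ]
    rcases hsp i with ⟨e₁, e₂⟩ | ⟨e₁, e₂⟩
    · exact Or.inl ⟨hsome₁ (by rw [e₁]; exact hΘi), hnone₂ e₂⟩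
    · exact Or.inr ⟨hnone₂ e₁, hsome₁ (by rw [e₂]; exact hΘi)⟩
  · have h0 : ∀ i, Δ i i' = none := fun i => by by_contra hne; exact h ⟨i, hne⟩
    have hr : ∀ Θ' : Ctx, Ctx.iUnion (restrictΔ Θ' Δ) i' = none := fun Θ' =>
      Ctx.iUnion_eq_none fun i => by
        cases hΘ : Θ' i with
        | none => rw [restrictΔ_of_none hΘ]; rfl
        | some τ => rw [restrictΔ_of_some hΘ]; exact h0 i
    refine Or.inl ⟨?_, hr Θ₂⟩
    rw [hr Θ₁, Ctx.iUnion_eq_none h0]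

/-- **Costs split along a context splitting.** [folklore] -/
theorem sum_restrictCost_split (hS : SubstData r D Θ θ Δ cost) {Θ₁ Θ₂ : Ctx} (hsp : Θ.Split Θ₁ Θ₂)
    (n : ℕ) :
    (Finset.range n).sum (restrictCost Θ₁ cost) + (Finset.range n).sum (restrictCost Θ₂ cost) =
      (Finset.range n).sum cost := by
  rw [← Finset.sum_add_distrib]
  refine Finset.sum_congr rfl fun i _ => ?_
  rcases hsp i with ⟨e₁, e₂⟩ | ⟨e₁, e₂⟩
  · rw [restrictCost_of_none e₂, Nat.add_zero]
    cases hΘ : Θ i with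
    | none => rw [restrictCost_of_none (e₁.trans hΘ), hS.cost_eq_zero hΘ]
    | some τ => rw [restrictCost_of_some (e₁.trans hΘ)]
  · rw [restrictCost_of_none e₁, Nat.zero_add]
    cases hΘ : Θ i with
    | none => rw [restrictCost_of_none (e₂.trans hΘ), hS.cost_eq_zero hΘ]
    | some τ => rw [restrictCost_of_some (e₂.trans hΘ)]

/-- Restricted costs are dominated by the costs. [folklore] -/
theorem sum_restrictCost_le (Θ₁ : Ctx) (cost : ℕ → ℕ) (n : ℕ) :
    (Finset.range n).sum (restrictCost Θ₁ cost) ≤ (Finset.range n).sum cost := by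
  refine Finset.sum_le_sum fun i _ => ?_
  cases hΘ : Θ₁ i with
  | none => rw [restrictCost_of_none hΘ]; exact Nat.zero_le _
  | some τ => rw [restrictCost_of_some hΘ]

/-! #### Passage under a term binder (case `(⊸I)`) -/

/-- The pieces under a binder: the new slot `0` is renamed to itself, the old pieces are
shifted. [folklore] -/
def upΔ (a : SoftTy) (Δ : ℕ → Ctx) : ℕ → Ctx
  | 0 => Ctx.cons (some a) Ctx.empty
  | i + 1 => Ctx.cons none (Δ i)

/-- The costs under a binder. [folklore] -/
def upCost (cost : ℕ → ℕ) : ℕ → ℕ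
  | 0 => 0
  | i + 1 => cost i

/-- **Substitution data under a term binder** (`θ ↦ ⇑θ`). [folklore] -/
theorem up (hS : SubstData r D Θ θ Δ cost) (a : SoftTy) :
    SubstData r D (Ctx.cons (some a) Θ) (Term.up θ) (upΔ a Δ) (upCost cost) where
  slot i τ hτ := by
    cases i with
    | zero =>
      simp only [Ctx.cons, Option.some.injEq] at hτ
      subst hτ
      refine Or.inl ⟨0, rfl, ⟨rfl, fun j hj => ?_⟩, rfl⟩
      cases j with
      | zero => exact absurd rfl hj
      | succ j => rfl
    | succ i =>
      simp only [Ctx.cons] at hτ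
      rcases hS.slot i τ hτ with ⟨i', hθ, hsing, hc⟩ | ⟨dᵢ, hd, hder⟩
      · refine Or.inl ⟨i' + 1, by simp [hθ, Term.rename], ⟨hsing.1, fun j hj => ?_⟩, hc⟩
        cases j with
        | zero => rfl
        | succ j => exact hsing.2 j (fun e => hj (by rw [e]))
      · exact Or.inr ⟨dᵢ, hd, by simpa [upΔ, upCost] using hder.shift_succ⟩
  off i hi := by
    cases i with
    | zero => simp [Ctx.cons] at hi
    | succ i =>
      simp only [Ctx.cons] at hi
      refine ⟨fun i' => ?_, by simp [upCost, hS.cost_eq_zero hi]⟩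
      cases i' with
      | zero => rfl
      | succ i' => exact (hS.off i hi).1 i'
  disj i₁ i₂ i' hne h := by
    cases i₁ with
    | zero =>
      cases i₂ with
      | zero => exact absurd rfl hne
      | succ i₂ =>
        cases i' with
        | zero => rfl
        | succ i' => simp [upΔ, Ctx.cons, Ctx.empty] at h
    | succ i₁ =>
      cases i' with
      | zero => simp [upΔ, Ctx.cons] at h
      | succ i' =>
        cases i₂ with
        | zero => rfl
        | succ i₂ => exact hS.disj i₁ i₂ i' (fun e => hne (by rw [e])) h
  bdd := by
    obtain ⟨m, hm⟩ := hS.bdd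
    refine ⟨m + 1, fun i i' hi' => ?_⟩
    cases i' with
    | zero => omega
    | succ i' =>
      cases i with
      | zero => rfl
      | succ i => exact hm i i' (by omega)

/-- The union under a binder. [folklore] -/
theorem iUnion_upΔ (hS : SubstData r D Θ θ Δ cost) (a : SoftTy) :
    Ctx.iUnion (upΔ a Δ) = Ctx.cons (some a) (Ctx.iUnion Δ) := by
  refine Ctx.iUnion_eq_of (hS.up a).disj (fun i i' hi => ?_) (fun i' hi' => ?_)
  · cases i with
    | zero =>
      cases i' with
      | zero => rfl
      | succ i' => simp [upΔ, Ctx.cons, Ctx.empty] at hi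
    | succ i =>
      cases i' with
      | zero => simp [upΔ, Ctx.cons] at hi
      | succ i' => exact Ctx.iUnion_apply hS.disj hi
  · cases i' with
    | zero => exact ⟨0, by simp [upΔ, Ctx.cons]⟩
    | succ i' =>
      obtain ⟨i, hi⟩ := Ctx.exists_of_iUnion_ne_none (Δ := Δ) hi'
      exact ⟨i + 1, hi⟩

/-- The total cost under a binder. [folklore] -/
theorem sum_upCost (cost : ℕ → ℕ) (n : ℕ) :
    (Finset.range (n + 1)).sum (upCost cost) = (Finset.range n).sum cost := by
  rw [Finset.sum_range_succ']
  simp [upCost]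

/-! #### Passage under a type binder (case `(∀I)`) -/

/-- **Substitution data under a type binder** (all types shifted). [folklore] -/
theorem shiftT (hS : SubstData r D Θ θ Δ cost) :
    SubstData r D Θ.shift θ (fun i => (Δ i).shift) cost where
  slot i τ hτ := by
    simp only [Ctx.shift] at hτ
    cases hΘ : Θ i with
    | none => simp [hΘ] at hτ
    | some τ₀ =>
      rw [hΘ] at hτ
      simp only [Option.map_some, Option.some.injEq] at hτ
      subst hτ
      rcases hS.slot i τ₀ hΘ with ⟨i', hθ, hsing, hc⟩ | ⟨dᵢ, hd, hder⟩
      · exact Or.inl ⟨i', hθ, ⟨by simp [Ctx.shift, hsing.1], fun j hj => by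
          simp [Ctx.shift, hsing.2 j hj]⟩, hc⟩
      · exact Or.inr ⟨dᵢ, hd, hder.shiftT⟩
  off i hi := by
    simp only [Ctx.shift, Option.map_eq_none_iff] at hi
    exact ⟨fun i' => by simp [Ctx.shift, (hS.off i hi).1 i'], hS.cost_eq_zero hi⟩
  disj i₁ i₂ i' hne h := by
    have h0 : Δ i₁ i' ≠ none := fun e => h (by simp [Ctx.shift, e])
    simp [Ctx.shift, hS.disj i₁ i₂ i' hne h0]
  bdd := by
    obtain ⟨m, hm⟩ := hS.bdd
    exact ⟨m, fun i i' hi' => by simp [Ctx.shift, hm i i' hi']⟩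

/-- The union under a type binder. [folklore] -/
theorem iUnion_shift (hS : SubstData r D Θ θ Δ cost) :
    Ctx.iUnion (fun i => (Δ i).shift) = (Ctx.iUnion Δ).shift :=
  Ctx.iUnion_map hS.disj SoftTy.shift

end SubstData

end STA

end Literature.Computability.ImplicitComplexity
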